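import Mathlib
import HarnessLib
import Summits.HodgeConjecture.HodgeConjecture.Theses.EightfoldBlochSeeds
import Summits.HodgeConjecture.HodgeConjecture.Theorems.WeilTypeLadderBlochSeed

/-!
# Route `EightfoldBlochSeeds` — the Assembly item (stmt-HodgeConjecture-18885)

The assembly statement of the route is the implication

  `BlochSeedsGeneric → BlochSeedDiscOne → BlochSeedDiscThree → ReachHyperbolic →
     BlochSpreadEightFour → SevenfoldWeilCensus.WeilSixfolds`.

It holds by the tree theorem
`Summit.HodgeConjecture.HodgeConjecture.WeilTypeLadder.weilSixfolds_of_reach_of_blochSpread_of_seeds_four`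
(Theorems/WeilTypeLadderBlochSeed.lean: reach of the hyperbolic Weil family ∧ Bloch's class-level
semiregular spreading at `(8, 4)` ∧ one hyperbolic Bloch seed in dimension 8 for EVERY `d > 0`
⟹ the leaf `WeilSixfolds`), after gluing the three seed cruxes — the generic one (`d ≠ 1, 3`),
the Gaussian one (`d = 1`) and the Eisenstein one (`d = 3`) — into the single hypothesis
`∀ d, 0 < d → HasHyperbolicBlochSeed 4 d` by a case split on `d`.

This file proves ONLY the glue. The five hypotheses stay exactly what they are in the route file:
three open seed cruxes and two refereed named facts taken BY NAME (`weilFamilyReach_hyperbolic`,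
`BlochSemiregularSpread 8 4`), none of them proved here. Nothing here says that any Weil class is
algebraic, and nothing here bears on HC ∕ HC_CM ∕ HC_AV.
-/

set_option linter.dupNamespace false

namespace Summit.HodgeConjecture.HodgeConjecture

open Summit.HodgeConjecture.HodgeConjecture.Theses.EightfoldBlochSeeds

/-- The three seed cruxes of the route glue to the seed hypothesis of the ladder theorem:
a hyperbolic Bloch seed in dimension 8 for every `d > 0` (case split `d = 1`, `d = 3`, else). -/
theorem EightfoldBlochSeeds.hasHyperbolicBlochSeed_four_of_seeds
    (h₂ : BlochSeedsGeneric) (h₃ : BlochSeedDiscOne) (h₄ : BlochSeedDiscThree) :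
    ∀ d : ℕ, 0 < d → Literature.AlgebraicGeometry.HodgeTheory.HasHyperbolicBlochSeed 4 d := by
  intro d hd
  by_cases h1 : d = 1
  · subst h1
    exact h₃
  by_cases h3 : d = 3
  · subst h3
    exact h₄
  exact h₂ d hd h1 h3

/-- **The Assembly item of route `EightfoldBlochSeeds` (stmt-HodgeConjecture-18885).**
The five route hypotheses — the seed cruxes `BlochSeedsGeneric`, `BlochSeedDiscOne`,
`BlochSeedDiscThree` and the refereed named facts `ReachHyperbolic`
(`= weilFamilyReach_hyperbolic`) and `BlochSpreadEightFour` (`= BlochSemiregularSpread (2 * 4) 4`)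
— imply the leaf `SevenfoldWeilCensus.WeilSixfolds`, by
`WeilTypeLadder.weilSixfolds_of_reach_of_blochSpread_of_seeds_four` applied to the glued seed
hypothesis. Pure composition; no hypothesis is discharged here. -/
theorem EightfoldBlochSeeds.Assembly_proof :
    Summit.HodgeConjecture.HodgeConjecture.Theses.EightfoldBlochSeeds.Assembly := by
  unfold Summit.HodgeConjecture.HodgeConjecture.Theses.EightfoldBlochSeeds.Assembly
  intro h₂ h₃ h₄ hF hB
  exact WeilTypeLadder.weilSixfolds_of_reach_of_blochSpread_of_seeds_four hF hB
    (EightfoldBlochSeeds.hasHyperbolicBlochSeed_four_of_seeds h₂ h₃ h₄)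

end Summit.HodgeConjecture.HodgeConjecture
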